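import Mathlib
import HarnessLib

/-!
# GridStability/Lyapunov/LaplacianEdgeSandwich — the EDGE SANDWICH for weighted graph Laplacians (G2-SCALE T-row T9; idea-2 cycle-4 card «modal-lag-line-dynamics-threshold» P2)

Venture GRIDFUSION, G2-SCALE cell (lead g19 §43 D60 (ii) / §44 D64: writer gridfusion-sos-5 (g10); draft = idea-2's REV 2 scratch
`HOME/idea-2/toy-g4/EdgeSandwich.lean` 55885e9216960863, crit-1 PASS·NC l.10531/32). GENERIC, Mathlib-only, no instance data, 0 kit —
reusable by every Laplacian object of the cell (dVOC `hlam` lane, Kuramoto/droop chains, the modal-lag card).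

For a symmetric nonnegative weight function `w : Fin N → Fin N → ℝ` (zero diagonal not needed except where said), degrees
`deg w k = Σⱼ w k j`, Laplacian form `lapForm w u = ½ Σₖ Σⱼ w k j (u k − u j)²`:
* UPPER (weighted Anderson–Morley, FORM version, by an AM–GM weighting — no line graph, no spectral theorem):
  `deg k + deg j ≤ Λ` whenever `w k j ≠ 0` ⇒ `lapForm w u ≤ Λ·Σ u²` (`lapForm_le`); matrix form `lapMatrix = diag(deg) − w`,
  `dotProduct_lapMatrix_mulVec`, and the algebraic eigenvalue bound `eigenvalue_le` (real eigenpair ⇒ `μ ≤ Λ`);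
* LOWER (2-sparse Rayleigh vector `e_k − e_j`, zero diagonal, `k ≠ j`): `lapForm w (e_k − e_j) = deg k + deg j + 2 w k j`,
  `‖e_k − e_j‖² = 2`, Rayleigh form `lapForm_indicator_sub_rayleigh`.
The eigenvalue LOWER half (`λ_max ≥` Rayleigh) is Courant–Fischer and not needed by certificates, which consume the form
inequalities. THREE COLUMNS: pure linear algebra; nothing here certifies a real grid. [folklore]
-/

namespace Summit.Ventures.GridStability.Lyapunov.EdgeSandwich

open Finset BigOperators

variable {N : ℕ}

/-- weighted degree [folklore] -/
def deg (w : Fin N → Fin N → ℝ) (k : Fin N) : ℝ := ∑ j, w k j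

/-- Laplacian quadratic form `½ Σ_k Σ_j w_kj (u_k − u_j)²` (each unordered pair counted twice, hence the ½). [folklore] -/
noncomputable def lapForm (w : Fin N → Fin N → ℝ) (u : Fin N → ℝ) : ℝ :=
  (1 / 2) * ∑ k, ∑ j, w k j * (u k - u j) ^ 2

/-- Per-pair AM–GM weighting: for `dk, dj > 0`, `(a − b)² ≤ (dk+dj)/dk · a² + (dk+dj)/dj · b²`. [folklore] -/
theorem sq_sub_le (dk dj a b : ℝ) (hk : 0 < dk) (hj : 0 < dj) :
    (a - b) ^ 2 ≤ (dk + dj) / dk * a ^ 2 + (dk + dj) / dj * b ^ 2 := by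
  rw [div_mul_eq_mul_div, div_mul_eq_mul_div, div_add_div _ _ hk.ne' hj.ne', le_div_iff₀ (mul_pos hk hj)]
  nlinarith [sq_nonneg (dj * a + dk * b), mul_pos hk hj, sq_nonneg a, sq_nonneg b]

/-- If `w k j > 0` and weights are nonnegative then `deg w k > 0`. [folklore] -/
theorem deg_pos_of_pos (w : Fin N → Fin N → ℝ) (hw : ∀ k j, 0 ≤ w k j) {k j : Fin N} (h : 0 < w k j) :
    0 < deg w k := by
  unfold deg
  calc (0 : ℝ) < w k j := h
    _ ≤ ∑ j, w k j := single_le_sum (fun i _ => hw k i) (mem_univ j)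

/-- WEIGHTED ANDERSON–MORLEY (form version): `deg k + deg j ≤ Λ` on every edge ⇒ `lapForm w u ≤ Λ ‖u‖²`. [folklore] -/
theorem lapForm_le (w : Fin N → Fin N → ℝ) (hsym : ∀ k j, w k j = w j k) (hw : ∀ k j, 0 ≤ w k j)
    (Λ : ℝ) (hΛ0 : 0 ≤ Λ) (hΛ : ∀ k j, w k j ≠ 0 → deg w k + deg w j ≤ Λ) (u : Fin N → ℝ) :
    lapForm w u ≤ Λ * ∑ k, u k ^ 2 := by
  -- Step 1: per-term bound w_kj (u_k - u_j)^2 ≤ w_kj [(d_k+d_j)/d_k u_k^2 + (d_k+d_j)/d_j u_j^2]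
  have step1 : ∀ k j, w k j * (u k - u j) ^ 2 ≤
      w k j * ((deg w k + deg w j) / deg w k * u k ^ 2) + w k j * ((deg w k + deg w j) / deg w j * u j ^ 2) := by
    intro k j
    rcases (hw k j).eq_or_lt with h0 | hpos
    · rw [← h0]; simp
    · have hk : 0 < deg w k := deg_pos_of_pos w hw hpos
      have hj : 0 < deg w j := deg_pos_of_pos w hw (by rw [hsym]; exact hpos)
      rw [← mul_add]
      exact mul_le_mul_of_nonneg_left (sq_sub_le _ _ _ _ hk hj) (hw k j)
  -- Step 2: per-term bound by Λ: w_kj (d_k+d_j)/d_k u_k^2 ≤ w_kj Λ/d_k u_k^2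
  have step2 : ∀ k j, w k j * ((deg w k + deg w j) / deg w k * u k ^ 2) ≤ w k j * (Λ / deg w k * u k ^ 2) := by
    intro k j
    rcases (hw k j).eq_or_lt with h0 | hpos
    · rw [← h0]; simp
    · have hk : 0 < deg w k := deg_pos_of_pos w hw hpos
      apply mul_le_mul_of_nonneg_left _ (hw k j)
      apply mul_le_mul_of_nonneg_right _ (sq_nonneg _)
      exact div_le_div_of_nonneg_right (hΛ k j hpos.ne') hk.le
  -- Step 3: row sums: Σ_j w_kj Λ/d_k u_k^2 = Λ u_k^2 (if d_k > 0) and ≤ Λ u_k^2 in general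
  have step3 : ∀ k, ∑ j, w k j * (Λ / deg w k * u k ^ 2) ≤ Λ * u k ^ 2 := by
    intro k
    rw [← sum_mul]
    change deg w k * (Λ / deg w k * u k ^ 2) ≤ Λ * u k ^ 2
    rcases eq_or_ne (deg w k) 0 with h0 | hne
    · rw [h0]; simp; positivity
    · rw [← mul_assoc, mul_div_cancel₀ _ hne]
  -- symmetric half: Σ_k Σ_j w_kj (d_k+d_j)/d_j u_j^2 = Σ_k Σ_j w_kj (d_k+d_j)/d_k u_k^2 (swap k, j; symmetry of w)
  have swap : ∑ k, ∑ j, w k j * ((deg w k + deg w j) / deg w j * u j ^ 2) =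
      ∑ k, ∑ j, w k j * ((deg w k + deg w j) / deg w k * u k ^ 2) := by
    rw [sum_comm]
    refine sum_congr rfl fun k _ => sum_congr rfl fun j _ => ?_
    rw [hsym j k, add_comm (deg w j) (deg w k)]
  unfold lapForm
  calc (1 / 2) * ∑ k, ∑ j, w k j * (u k - u j) ^ 2
      ≤ (1 / 2) * ∑ k, ∑ j, (w k j * ((deg w k + deg w j) / deg w k * u k ^ 2)
          + w k j * ((deg w k + deg w j) / deg w j * u j ^ 2)) := by
        apply mul_le_mul_of_nonneg_left _ (by norm_num : (0:ℝ) ≤ 1 / 2)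
        exact sum_le_sum fun k _ => sum_le_sum fun j _ => step1 k j
    _ = ∑ k, ∑ j, w k j * ((deg w k + deg w j) / deg w k * u k ^ 2) := by
        have hsplit : ∑ k, ∑ j, (w k j * ((deg w k + deg w j) / deg w k * u k ^ 2)
            + w k j * ((deg w k + deg w j) / deg w j * u j ^ 2))
            = ∑ k, ∑ j, w k j * ((deg w k + deg w j) / deg w k * u k ^ 2)
              + ∑ k, ∑ j, w k j * ((deg w k + deg w j) / deg w j * u j ^ 2) := by
          rw [← sum_add_distrib]; exact sum_congr rfl fun k _ => sum_add_distrib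
        rw [hsplit, swap]; ring
    _ ≤ ∑ k, ∑ j, w k j * (Λ / deg w k * u k ^ 2) :=
        sum_le_sum fun k _ => sum_le_sum fun j _ => step2 k j
    _ ≤ ∑ k, Λ * u k ^ 2 := sum_le_sum fun k _ => step3 k
    _ = Λ * ∑ k, u k ^ 2 := by rw [mul_sum]

/-- Bilinear expansion of the Laplacian form for symmetric weights: `lapForm w u = Σ_k deg_k u_k² − Σ_k Σ_j w_kj u_k u_j`. [folklore] -/
theorem lapForm_eq (w : Fin N → Fin N → ℝ) (hsym : ∀ k j, w k j = w j k) (u : Fin N → ℝ) :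
    lapForm w u = ∑ k, deg w k * u k ^ 2 - ∑ k, ∑ j, w k j * (u k * u j) := by
  unfold lapForm deg
  have h1 : ∑ k, ∑ j, w k j * (u k - u j) ^ 2
      = ∑ k, ∑ j, w k j * u k ^ 2 + ∑ k, ∑ j, w k j * u j ^ 2 - 2 * ∑ k, ∑ j, w k j * (u k * u j) := by
    rw [mul_sum, ← sum_add_distrib, ← sum_sub_distrib]
    refine sum_congr rfl fun k _ => ?_
    rw [mul_sum, ← sum_add_distrib, ← sum_sub_distrib]
    refine sum_congr rfl fun j _ => ?_
    ring
  have h2 : ∑ k, ∑ j, w k j * u j ^ 2 = ∑ k, ∑ j, w k j * u k ^ 2 := by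
    rw [sum_comm]
    exact sum_congr rfl fun k _ => sum_congr rfl fun j _ => by rw [hsym]
  have h3 : ∑ k, ∑ j, w k j * u k ^ 2 = ∑ k, (∑ j, w k j) * u k ^ 2 := by
    refine sum_congr rfl fun k _ => ?_
    rw [sum_mul]
  rw [h1, h2, h3]
  ring

/-- 2-SPARSE RAYLEIGH VECTOR: for zero-diagonal symmetric weights and `k ≠ j`, the form at `u = e_k − e_j` equals
`deg k + deg j + 2 w k j` while `‖u‖² = 2` — Rayleigh quotient `w k j + (deg k + deg j)/2`. [folklore] -/
theorem lapForm_indicator_sub (w : Fin N → Fin N → ℝ) (hsym : ∀ k j, w k j = w j k) (hdiag : ∀ k, w k k = 0)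
    {k j : Fin N} (hkj : k ≠ j) :
    lapForm w (fun i => (if i = k then 1 else 0) - (if i = j then 1 else 0)) = deg w k + deg w j + 2 * w k j := by
  rw [lapForm_eq w hsym]
  simp [sub_sq, mul_sub, mul_add, sum_add_distrib, sum_sub_distrib, Finset.sum_ite_eq',
    mul_ite, hkj.symm, hdiag, hsym j k]
  ring

/-- The squared norm of `e_k − e_j` is `2` (for `k ≠ j`). [folklore] -/
theorem normSq_indicator_sub {k j : Fin N} (hkj : k ≠ j) :
    ∑ i, ((if i = k then (1:ℝ) else 0) - (if i = j then 1 else 0)) ^ 2 = 2 := by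
  simp [sub_sq, sum_add_distrib, sum_sub_distrib, Finset.sum_ite_eq', mul_ite, hkj.symm]
  norm_num

/-- EDGE SANDWICH, lower half in Rayleigh form: `lapForm w (e_k − e_j) = (w k j + (deg k + deg j)/2) · ‖e_k − e_j‖²`. [folklore] -/
theorem lapForm_indicator_sub_rayleigh (w : Fin N → Fin N → ℝ) (hsym : ∀ k j, w k j = w j k)
    (hdiag : ∀ k, w k k = 0) {k j : Fin N} (hkj : k ≠ j) :
    lapForm w (fun i => (if i = k then 1 else 0) - (if i = j then 1 else 0))
      = (w k j + (deg w k + deg w j) / 2)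
        * ∑ i, ((if i = k then (1:ℝ) else 0) - (if i = j then 1 else 0)) ^ 2 := by
  rw [lapForm_indicator_sub w hsym hdiag hkj, normSq_indicator_sub hkj]
  ring


/-! ## Matrix form and the eigenvalue upper bound (no spectral theorem needed) -/

/-- The weighted Laplacian matrix `diag(deg) − w` (for zero-diagonal weights this is `ℬ diag(w_e) ℬᵀ`). [folklore] -/
noncomputable def lapMatrix (w : Fin N → Fin N → ℝ) : Matrix (Fin N) (Fin N) ℝ :=
  Matrix.of fun k j => (if k = j then deg w k else 0) - w k j

/-- The matrix quadratic form of `lapMatrix w` is `lapForm w` (symmetric weights). [folklore] -/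
theorem dotProduct_lapMatrix_mulVec (w : Fin N → Fin N → ℝ) (hsym : ∀ k j, w k j = w j k) (u : Fin N → ℝ) :
    dotProduct u ((lapMatrix w).mulVec u) = lapForm w u := by
  rw [lapForm_eq w hsym]
  unfold lapMatrix
  simp only [Matrix.mulVec, dotProduct, Matrix.of_apply, sub_mul, sum_sub_distrib, ite_mul, zero_mul,
    Finset.sum_ite_eq, Finset.mem_univ, if_true, mul_sub, mul_sum]
  congr 1
  · exact sum_congr rfl fun k _ => by ring
  · exact sum_congr rfl fun k _ => sum_congr rfl fun j _ => by ring

/-- EIGENVALUE UPPER BOUND (weighted Anderson–Morley): every real eigenvalue `μ` of `lapMatrix w` (with a real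
eigenvector) satisfies `μ ≤ Λ` whenever `deg k + deg j ≤ Λ` on every edge. Purely algebraic: no spectral theorem. [folklore] -/
theorem eigenvalue_le (w : Fin N → Fin N → ℝ) (hsym : ∀ k j, w k j = w j k) (hw : ∀ k j, 0 ≤ w k j)
    (Λ : ℝ) (hΛ0 : 0 ≤ Λ) (hΛ : ∀ k j, w k j ≠ 0 → deg w k + deg w j ≤ Λ)
    (μ : ℝ) (u : Fin N → ℝ) (hu : u ≠ 0) (heig : (lapMatrix w).mulVec u = μ • u) : μ ≤ Λ := by
  have hform : dotProduct u ((lapMatrix w).mulVec u) = μ * ∑ k, u k ^ 2 := by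
    rw [heig, dotProduct_smul, smul_eq_mul]
    congr 1
    unfold dotProduct
    exact sum_congr rfl fun k _ => by ring
  have hle := lapForm_le w hsym hw Λ hΛ0 hΛ u
  rw [← dotProduct_lapMatrix_mulVec w hsym u, hform] at hle
  have hpos : 0 < ∑ k, u k ^ 2 := by
    obtain ⟨k, hk⟩ : ∃ k, u k ≠ 0 := by
      by_contra h
      push Not at h
      exact hu (funext h)
    calc (0 : ℝ) < u k ^ 2 := by positivity
      _ ≤ ∑ k, u k ^ 2 := single_le_sum (fun i _ => sq_nonneg (u i)) (mem_univ k)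
  exact le_of_mul_le_mul_right hle hpos

end Summit.Ventures.GridStability.Lyapunov.EdgeSandwich
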